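import Mathlib
import Summits.ValiantsHypothesis.ValiantsHypothesis.Theses.FermionizationDimension

/-!
# The Grassmann point `s(n) ≤ C(2n, n)` of the commutative twisting dimension of `sgn`

Route `FermionizationDimension` of `ValiantsHypothesis`, support item `GrassmannUpperBound`
(stmt-ValiantsHypothesis-7290): for every `n` there is a commutative `ℂ`-algebra `R` with
`finrank ℂ R ≤ Nat.centralBinom n`, a matrix `u : Fin n → Fin n → R` and a linear functional
`ℓ : R →ₗ[ℂ] ℂ` with `ℓ (∏ i, u (σ i) i) = sgn σ` for every permutation `σ`.

## Construction ("fermionization")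

Let `Λ := ExteriorAlgebra ℂ (Fin n → ℂ)` with odd generators `α_a := ι (e_a)`.  Inside the
(ungraded) tensor product of algebras `Λ ⊗[ℂ] Λ` the elements `u_{ab} := α_a ⊗ α_b` commute
pairwise (the two anticommutation signs cancel), so `R := Algebra.adjoin ℂ {u_{ab}}` is a
commutative subalgebra.  It is contained in the span of the tensors `B_S ⊗ B_T` of Mathlib's
finset-indexed basis `B` of `Λ` with `|S| = |T|`, a family with at most
`#{(S, T) : |S| = |T|} ≤ C(2n, n)` members (inject `(S, T) ↦ Sᶜ ⊔ T ⊆ Fin n ⊕ Fin n`).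
For the functional take `ℓ := det ⊗ det`, obtained from `ExteriorAlgebra.liftAlternating`
applied to `Matrix.detRowAlternating` in degree `n`; then
`ℓ (∏ i, u_{σ i, i}) = det (P_σ) * det 1 = sgn σ`.

This is the fermionic point of the route thesis (Shafiei 2015 / Landsberg 2017 §10.1: the even
Grassmann algebra generated by the `α_a β_b`, i.e. the apolar algebra of `det_n`); the algebra
used here differs from that one only by the symmetric cocycle `(-1)^{|S|·|S'|}`, so both are
commutative of dimension `C(2n, n)`.  No published fact is assumed: the file is unconditional,
and it introduces no definition.
-/

-- `Summit.ValiantsHypothesis.ValiantsHypothesis.…` is the tree's mandated single-conjunct layout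
-- (Sub = Summit), so the duplicated namespace component is intended.
set_option linter.dupNamespace false

namespace Summit.ValiantsHypothesis.ValiantsHypothesis.Theorems

open scoped TensorProduct
open scoped IsMulCommutative
open ExteriorAlgebra

section Model

/-- In an algebra tensor square of an exterior algebra, an ordered product of elementary tensors
of generators is the tensor of the two ordered wedge products. -/
theorem grassmannUB_prod_ofFn_tmul {M : Type*} [AddCommGroup M] [Module ℂ M] :
    ∀ (m : ℕ) (w w' : Fin m → M),
      (List.ofFn fun i => (ι ℂ (w i) ⊗ₜ[ℂ] ι ℂ (w' i) :
        ExteriorAlgebra ℂ M ⊗[ℂ] ExteriorAlgebra ℂ M)).prod =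
        ιMulti ℂ m w ⊗ₜ[ℂ] ιMulti ℂ m w'
  | 0, w, w' => by
    rw [List.ofFn_zero, List.prod_nil, ιMulti_zero_apply, ιMulti_zero_apply,
      Algebra.TensorProduct.one_def]
  | m + 1, w, w' => by
    rw [List.ofFn_succ, List.prod_cons, grassmannUB_prod_ofFn_tmul m, ιMulti_succ_apply,
      ιMulti_succ_apply, Algebra.TensorProduct.tmul_mul_tmul]
    rfl

/-- Two elementary tensors of odd generators commute in the (ungraded) tensor square of an
exterior algebra: the two anticommutation signs cancel. -/
theorem grassmannUB_gen_comm {M : Type*} [AddCommGroup M] [Module ℂ M] (x y x' y' : M) :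
    (ι ℂ x ⊗ₜ[ℂ] ι ℂ y : ExteriorAlgebra ℂ M ⊗[ℂ] ExteriorAlgebra ℂ M) * (ι ℂ x' ⊗ₜ[ℂ] ι ℂ y') =
      (ι ℂ x' ⊗ₜ[ℂ] ι ℂ y') * (ι ℂ x ⊗ₜ[ℂ] ι ℂ y) := by
  rw [Algebra.TensorProduct.tmul_mul_tmul, Algebra.TensorProduct.tmul_mul_tmul,
    eq_neg_of_add_eq_zero_left (ι_add_mul_swap x x'),
    eq_neg_of_add_eq_zero_left (ι_add_mul_swap y y'), TensorProduct.neg_tmul,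
    TensorProduct.tmul_neg, neg_neg]

/-- The singleton element of Mathlib's finset-indexed basis of the exterior algebra is the
generator itself. -/
theorem grassmannUB_basis_singleton {M : Type*} [AddCommGroup M] [Module ℂ M] {I : Type*}
    [LinearOrder I] (b : Module.Basis I ℂ M) (a : I) :
    b.ExteriorAlgebra {a} = ι ℂ (b a) := by
  rw [ExteriorAlgebra.basis_apply_ofCard b (Finset.card_singleton a), ιMulti_family,
    ιMulti_succ_apply, ιMulti_zero_apply, mul_one, Function.comp_apply,
    Set.powersetCard.ofFinEmbEquiv_symm_apply]
  exact congrArg (fun i => ι ℂ (b i)) (Finset.orderEmbOfFin_singleton a 0)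

/-- The empty-set element of Mathlib's finset-indexed basis of the exterior algebra is `1`. -/
theorem grassmannUB_basis_empty {M : Type*} [AddCommGroup M] [Module ℂ M] {I : Type*}
    [LinearOrder I] (b : Module.Basis I ℂ M) :
    b.ExteriorAlgebra ∅ = 1 := by
  rw [ExteriorAlgebra.basis_apply_ofCard b Finset.card_empty, ιMulti_family, ιMulti_zero_apply]

/-- Product rule for Mathlib's finset-indexed basis of the exterior algebra, in the weak form
needed here: `B S * B S'` is `0`, or `± B U` for a finset `U` with `|U| = |S| + |S'|`. -/
theorem grassmannUB_basis_mul {M : Type*} [AddCommGroup M] [Module ℂ M] {I : Type*}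
    [LinearOrder I] (b : Module.Basis I ℂ M) (S S' : Finset I) :
    b.ExteriorAlgebra S * b.ExteriorAlgebra S' = 0 ∨
      ∃ U : Finset I, U.card = S.card + S'.card ∧
        (b.ExteriorAlgebra S * b.ExteriorAlgebra S' = b.ExteriorAlgebra U ∨
          b.ExteriorAlgebra S * b.ExteriorAlgebra S' = -b.ExteriorAlgebra U) := by
  let s : Set.powersetCard I S.card := Set.powersetCard.ofCard rfl
  let t : Set.powersetCard I S'.card := Set.powersetCard.ofCard rfl
  by_cases h : Disjoint s.val t.val
  · right
    have key : b.ExteriorAlgebra S * b.ExteriorAlgebra S' = _ :=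
      ExteriorAlgebra.basis_mul_of_disjoint b s t h
    refine ⟨(Set.powersetCard.disjUnion h : Set.powersetCard I (S.card + S'.card)),
      Set.powersetCard.card_eq _, ?_⟩
    rcases Int.units_eq_one_or (Set.powersetCard.permOfDisjoint h).sign with h1 | h1
    · left
      rw [h1, one_smul] at key
      exact key
    · right
      rw [h1, Units.neg_smul, one_smul] at key
      exact key
  · left
    exact ExteriorAlgebra.basis_mul_of_not_disjoint b s t h

/-- Counting the index set: pairs of finsets of `Fin n` of equal size inject into the
`n`-subsets of `Fin n ⊕ Fin n` via `(S, T) ↦ Sᶜ ⊔ T`, whence there are at most `C(2n, n)`. -/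
theorem grassmannUB_card_pairs (n : ℕ) :
    Fintype.card {p : Finset (Fin n) × Finset (Fin n) // p.1.card = p.2.card} ≤
      Nat.centralBinom n := by
  classical
  let φ : {p : Finset (Fin n) × Finset (Fin n) // p.1.card = p.2.card} →
      ↥(Finset.powersetCard n (Finset.univ : Finset (Fin n ⊕ Fin n))) := fun p =>
    ⟨(p.1.1ᶜ).disjSum p.1.2, by
      rw [Finset.mem_powersetCard]
      refine ⟨Finset.subset_univ _, ?_⟩
      have h1 : p.1.1.card ≤ n := (Finset.card_le_univ _).trans (by simp)
      have h2 := p.2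
      rw [Finset.card_disjSum, Finset.card_compl, Fintype.card_fin]
      omega⟩
  have hφ : Function.Injective φ := by
    rintro ⟨⟨S, T⟩, hST⟩ ⟨⟨S', T'⟩, hST'⟩ h
    simp only [φ, Subtype.mk.injEq] at h
    have hl := congrArg Finset.toLeft h
    have hr := congrArg Finset.toRight h
    simp only [Finset.toLeft_disjSum, Finset.toRight_disjSum, compl_inj_iff] at hl hr
    subst hl hr
    rfl
  refine (Fintype.card_le_of_injective φ hφ).trans ?_
  rw [Fintype.card_coe, Finset.card_powersetCard, Finset.card_univ, Fintype.card_sum,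
    Fintype.card_fin, Nat.centralBinom, two_mul]

end Model

open Summit.ValiantsHypothesis.ValiantsHypothesis.Theses.FermionizationDimension in
/-- **Grassmann upper bound** (route `FermionizationDimension`, item stmt-ValiantsHypothesis-7290):
the sign character of `S_n` is realised multiplicatively, through a linear functional, by an
`n × n` matrix over a commutative `ℂ`-algebra of dimension at most `C(2n, n)` — namely the
subalgebra of `Λ(ℂⁿ) ⊗ Λ(ℂⁿ)` generated by the elementary tensors of odd generators, with the
functional `det ⊗ det`. -/
theorem grassmannUpperBound_proof : GrassmannUpperBound := by
  classical
  intro n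
  -- the model: generators `ι (e a) ⊗ ι (e c)` of `Λ ⊗ Λ`, `Λ = ExteriorAlgebra ℂ (Fin n → ℂ)`
  let b : Module.Basis (Fin n) ℂ (Fin n → ℂ) := Pi.basisFun ℂ (Fin n)
  let gen : Fin n × Fin n → ExteriorAlgebra ℂ (Fin n → ℂ) ⊗[ℂ] ExteriorAlgebra ℂ (Fin n → ℂ) :=
    fun ac => ι ℂ (b ac.1) ⊗ₜ[ℂ] ι ℂ (b ac.2)
  let G := Set.range gen
  -- the spanning family controlling the dimension
  let J : Type := {p : Finset (Fin n) × Finset (Fin n) // p.1.card = p.2.card}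
  let v : J → ExteriorAlgebra ℂ (Fin n → ℂ) ⊗[ℂ] ExteriorAlgebra ℂ (Fin n → ℂ) :=
    fun p => b.ExteriorAlgebra p.1.1 ⊗ₜ[ℂ] b.ExteriorAlgebra p.1.2
  let N := Submodule.span ℂ (Set.range v)
  have hv : ∀ p : J, v p ∈ N := fun p => Submodule.subset_span ⟨p, rfl⟩
  have hN_one : 1 ∈ N := by
    have h : b.ExteriorAlgebra ∅ ⊗ₜ[ℂ] b.ExteriorAlgebra ∅ ∈ N := hv ⟨(∅, ∅), rfl⟩
    rw [grassmannUB_basis_empty] at h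
    rwa [Algebra.TensorProduct.one_def]
  have hN_mul : ∀ x y, x ∈ N → y ∈ N → x * y ∈ N := by
    suffices hNN : N * N ≤ N from fun x y hx hy => hNN (Submodule.mul_mem_mul hx hy)
    rw [Submodule.span_mul_span, Submodule.span_le]
    rintro _ ⟨_, ⟨⟨⟨S, T⟩, hST⟩, rfl⟩, _, ⟨⟨⟨S', T'⟩, hST'⟩, rfl⟩, rfl⟩
    simp only [v, SetLike.mem_coe, Algebra.TensorProduct.tmul_mul_tmul]
    simp only at hST hST'
    rcases grassmannUB_basis_mul b S S' with h0 | ⟨U, hU, hSU⟩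
    · rw [h0, TensorProduct.zero_tmul]; exact N.zero_mem
    rcases grassmannUB_basis_mul b T T' with h0' | ⟨V, hV, hTV⟩
    · rw [h0', TensorProduct.tmul_zero]; exact N.zero_mem
    have hUV : U.card = V.card := by rw [hU, hV, hST, hST']
    have key : b.ExteriorAlgebra U ⊗ₜ[ℂ] b.ExteriorAlgebra V ∈ N := hv ⟨(U, V), hUV⟩
    rcases hSU with h1 | h1 <;> rcases hTV with h2 | h2 <;>
      simp only [h1, h2, TensorProduct.neg_tmul, TensorProduct.tmul_neg, neg_neg] <;>
      first | exact key | exact N.neg_mem key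
  let A := N.toSubalgebra hN_one hN_mul
  have hGA : G ⊆ ↑A := by
    rintro _ ⟨⟨a, c⟩, rfl⟩
    have h := hv ⟨(({a} : Finset (Fin n)), ({c} : Finset (Fin n))), by simp⟩
    simp only [v, grassmannUB_basis_singleton] at h
    exact h
  -- the commutative algebra `R := Algebra.adjoin ℂ G`
  have hcomm : ∀ x ∈ G, ∀ y ∈ G, x * y = y * x := by
    rintro _ ⟨⟨a, c⟩, rfl⟩ _ ⟨⟨a', c'⟩, rfl⟩
    exact grassmannUB_gen_comm (b a) (b c) (b a') (b c')
  haveI hRcomm : IsMulCommutative ↥(Algebra.adjoin ℂ G) :=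
    Algebra.isMulCommutative_adjoin ℂ hcomm
  -- finiteness
  haveI : Module.Finite ℂ (ExteriorAlgebra ℂ (Fin n → ℂ)) :=
    Module.Finite.of_basis b.ExteriorAlgebra
  haveI : Module.Finite ℂ ↥(Algebra.adjoin ℂ G) :=
    Module.Finite.of_injective (Algebra.adjoin ℂ G).val.toLinearMap Subtype.val_injective
  haveI : Module.Finite ℂ N := Module.Finite.span_of_finite ℂ (Set.finite_range v)
  -- the matrix and the functional `ℓ = det ⊗ det`
  let u : Fin n → Fin n → ↥(Algebra.adjoin ℂ G) := fun a c =>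
    ⟨gen (a, c), Algebra.subset_adjoin ⟨(a, c), rfl⟩⟩
  let ℓΛ := ExteriorAlgebra.liftAlternating (R := ℂ) (M := Fin n → ℂ) (N := ℂ)
    (Function.update (0 : (i : ℕ) → ((Fin n → ℂ) [⋀^Fin i]→ₗ[ℂ] ℂ)) n Matrix.detRowAlternating)
  let ℓ2 := LinearMap.mul' ℂ ℂ ∘ₗ TensorProduct.map ℓΛ ℓΛ
  let ℓ : ↥(Algebra.adjoin ℂ G) →ₗ[ℂ] ℂ := ℓ2 ∘ₗ (Algebra.adjoin ℂ G).val.toLinearMap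
  have hℓΛ : ∀ w : Fin n → Fin n → ℂ, ℓΛ (ιMulti ℂ n w) = Matrix.det (Matrix.of w) := by
    intro w
    simp only [ℓΛ]
    rw [liftAlternating_apply_ιMulti, Function.update_self]
    rfl
  refine ⟨↥(Algebra.adjoin ℂ G), inferInstance, inferInstance, inferInstance, u, ℓ, ?_, ?_⟩
  · -- dimension count
    have hle : Subalgebra.toSubmodule (Algebra.adjoin ℂ G) ≤ N := fun x hx =>
      (Algebra.adjoin_le hGA : Algebra.adjoin ℂ G ≤ A) hx
    have h1 : Module.finrank ℂ N ≤ Fintype.card J := finrank_range_le_card (R := ℂ) v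
    calc Module.finrank ℂ ↥(Algebra.adjoin ℂ G)
        = Module.finrank ℂ (Subalgebra.toSubmodule (Algebra.adjoin ℂ G)) :=
          (Subalgebra.finrank_toSubmodule _).symm
      _ ≤ Module.finrank ℂ N := Submodule.finrank_mono hle
      _ ≤ Fintype.card J := h1
      _ ≤ Nat.centralBinom n := grassmannUB_card_pairs n
  · -- the sign character
    intro σ
    have hprod : (Algebra.adjoin ℂ G).val (∏ i, u (σ i) i) =
        ιMulti ℂ n (fun i => b (σ i)) ⊗ₜ[ℂ] ιMulti ℂ n (fun i => b i) := by
      rw [← List.prod_ofFn, ← grassmannUB_prod_ofFn_tmul, map_list_prod, List.map_ofFn]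
      rfl
    have hP : (Matrix.of fun i => b (σ i)) = (1 : Matrix (Fin n) (Fin n) ℂ).submatrix σ id := by
      ext i j
      simp [b, Matrix.one_apply, Pi.single_apply, eq_comm]
    have hI : (Matrix.of fun i => b i) = (1 : Matrix (Fin n) (Fin n) ℂ) := by
      ext i j
      simp [b, Matrix.one_apply, Pi.single_apply, eq_comm]
    change ℓ2 ((Algebra.adjoin ℂ G).val (∏ i, u (σ i) i)) = _
    rw [hprod]
    simp only [ℓ2, LinearMap.comp_apply, TensorProduct.map_tmul, LinearMap.mul'_apply, hℓΛ, hP,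
      hI, Matrix.det_permute, Matrix.det_one, mul_one]

end Summit.ValiantsHypothesis.ValiantsHypothesis.Theorems
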